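import Summits.CriticalPhenomena.CardyFormulaZ2.Theses.CardyPolygonWords
import Summits.CriticalPhenomena.CardyFormulaZ2.Theorems.CardyBoundaryCoulombGasStripClusterRatesOfRectilinearCardy
import Summits.CriticalPhenomena.CardyFormulaZ2.Theorems.CardyBoundaryCoulombGasStripClusterRatesRectCardyOneOfRectilinearCardy

/-!
# The γ₁-half of `StripClusterRates` from Cardy's formula for corner-marked RECTANGLES alone

Support file for line `two-cluster-rate-is-stationary-gap` (crux `StripClusterRates`,
stmt-CriticalPhenomena-13878), lead c4. The registered stub `stub_rectCardyOne` (RC₁: Cardy's value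
`F(λ(iA))` for the lattice rectangles `[0, A·k−2] × [0, k−2]`, `k → ∞`, every integer aspect `A ≥ 1`) was
discharged by lead c3 from the route's crux 4 `RectilinearCardy` (Cardy for every rectilinear conformal
rectangle). The only instance of crux 4 that the proof uses is the corner-marked box `(0,A)×(0,1)`
(`rc_exists_boxRect`), so RC₁ already follows from the much smaller shared item `CardyRectangle` of route
`CardyPolygonWords` (stmt-CriticalPhenomena-4782: Cardy's formula for every rectangle `(0,a)×(0,b)` with its
four corners marked) — `rc_rectCardyOne_of_cardyRectangle`. Consequently (`oneClusterKac_of_cardyRectangle`)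
the γ₁-half of the crux, `n·γ₁(n) → π/3` for every family of one-cluster lengthwise rates, is a corollary
of `CardyRectangle`, and (`stripClusterRates_of_cardyRectangle_of_kacTwo`) the crux follows from
`CardyRectangle` and the two-cluster Kac gap statement K₂ (registered stub `stub_kacTwo`, inlined).
Logical position recorded by this file and `…OfCardyFormulaZ2`:
`CardyFormulaZ2 → RectilinearCardy → CardyRectangle → RC₁ → (γ₁-half)`, and `crux ↔ (γ₁-half) ∧ K₂`.
No definitions are introduced.
-/

noncomputable section

namespace Summit.CriticalPhenomena.CardyFormulaZ2.Cruxes.StripClusterRates.TwoClusterRateIsStationaryGap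

open Set Filter
open scoped Topology
open Literature.Probability.RandomPlanarGeometry
open Literature.Probability.Percolation (bondDomainCrossingProb crossingProb half)
open Literature.Probability.LatticeModels (PlanarRowState planarTransfer)
open Summit.CriticalPhenomena.CardyFormulaZ2.Theses.CardyPolygonWords (CardyRectangle)

/-- **Crux 4 specialises to `CardyRectangle`**: Cardy's formula for every rectilinear conformal rectangle
gives it for the corner-marked rectangles `(0,a)×(0,b)` (their frontier lies in four axis-parallel
segments). [folklore] -/
theorem cardyRectangle_of_rectilinearCardy :
    Summit.CriticalPhenomena.CardyFormulaZ2.Theses.CardyBoundaryCoulombGas.RectilinearCardy →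
      Summit.CriticalPhenomena.CardyFormulaZ2.Theses.CardyPolygonWords.CardyRectangle := by
  intro h R a b ha hb hcar _
  refine h R ⟨{((0 : ℂ), ((a : ℂ))), (((a : ℂ)), (a : ℂ) + (b : ℂ) * Complex.I),
    ((a : ℂ) + (b : ℂ) * Complex.I, (b : ℂ) * Complex.I), ((b : ℂ) * Complex.I, (0 : ℂ))}, ?_, ?_⟩
  · intro p hp
    simp only [Finset.mem_insert, Finset.mem_singleton] at hp
    rcases hp with rfl | rfl | rfl | rfl <;> simp
  · -- the frontier of the open box is contained in the boundary of the closed box, i.e. in the four sides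
    have hcar' : R.carrier = Set.Ioo (0 : ℝ) a ×ℂ Set.Ioo (0 : ℝ) b := by
      rw [hcar]; ext z; simp [Complex.mem_reProdIm, and_assoc]
    intro z hz
    rw [hcar', Complex.frontier_reProdIm, closure_Ioo ha.ne, closure_Ioo hb.ne, frontier_Ioo ha,
      frontier_Ioo hb] at hz
    simp only [Set.mem_union, Complex.mem_reProdIm, Set.mem_Icc, Set.mem_insert_iff,
      Set.mem_singleton_iff] at hz
    simp only [Set.mem_iUnion, Finset.mem_insert, Finset.mem_singleton, exists_prop]
    rcases hz with ⟨⟨h0re, hrea⟩, him | him⟩ | ⟨hre | hre, h0im, himb⟩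
    · -- bottom side `im z = 0`
      refine ⟨((0 : ℂ), ((a : ℂ))), by simp, ?_⟩
      rw [segment_eq_image']
      refine ⟨z.re / a, ⟨div_nonneg h0re ha.le, (div_le_one ha).mpr hrea⟩, ?_⟩
      apply Complex.ext
      · simp; field_simp
      · simp [him]
    · -- top side `im z = b`
      refine ⟨((a : ℂ) + (b : ℂ) * Complex.I, (b : ℂ) * Complex.I), by simp, ?_⟩
      rw [segment_eq_image']
      refine ⟨1 - z.re / a, ⟨by rw [sub_nonneg, div_le_one ha]; exact hrea,
        by linarith [div_nonneg h0re ha.le]⟩, ?_⟩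
      apply Complex.ext
      · simp; field_simp; ring
      · simp [him]
    · -- left side `re z = 0`
      refine ⟨((b : ℂ) * Complex.I, (0 : ℂ)), by simp, ?_⟩
      rw [segment_eq_image']
      refine ⟨1 - z.im / b, ⟨by rw [sub_nonneg, div_le_one hb]; exact himb,
        by linarith [div_nonneg h0im hb.le]⟩, ?_⟩
      apply Complex.ext
      · simp [hre]
      · simp; field_simp; ring
    · -- right side `re z = a`
      refine ⟨(((a : ℂ)), (a : ℂ) + (b : ℂ) * Complex.I), by simp, ?_⟩
      rw [segment_eq_image']
      refine ⟨z.im / b, ⟨div_nonneg h0im hb.le, (div_le_one hb).mpr himb⟩, ?_⟩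
      apply Complex.ext
      · simp [hre]
      · simp; field_simp

/-- **`CardyRectangle` ⇒ Cardy's value for the lattice rectangles** (RC₁ = registered stub
`stub_rectCardyOne`, from the shared item stmt-CriticalPhenomena-4782 instead of crux 4): if Cardy's formula
holds for every corner-marked rectangle `(0,a)×(0,b)`, then for every integer aspect `A ≥ 1`,
`P_{1/2}[LR crossing of [0, A·k−2] × [0, k−2]] → F(λ(iA))` as `k → ∞` — the box `(0,A)×(0,1)` of
`rc_exists_boxRect`, the dictionary `rc_box_dictionary`, the modulus `rectangle_crossRatio_eq_lamR`. [folklore] -/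
theorem rc_rectCardyOne_of_cardyRectangle :
    Summit.CriticalPhenomena.CardyFormulaZ2.Theses.CardyPolygonWords.CardyRectangle →
      ∀ A : ℕ, 1 ≤ A → Filter.Tendsto (fun k : ℕ ↦
      Literature.Probability.Percolation.crossingProb Literature.Probability.Percolation.half (A * k - 2) (k - 2))
      Filter.atTop (nhds (Literature.Probability.RandomPlanarGeometry.cardyFunction
        (Literature.Probability.RandomPlanarGeometry.KlebanZagier.lamR A))) := by
  intro hCR A hA
  obtain ⟨R, hcar, harc0, harc2, hpt, -⟩ := rc_exists_boxRect A hA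
  have hA' : (0 : ℝ) < A := by exact_mod_cast hA
  -- `CardyRectangle` on the corner-marked box `(0,A)×(0,1)`
  have hcar' : R.carrier = {z : ℂ | 0 < z.re ∧ z.re < (A : ℝ) ∧ 0 < z.im ∧ z.im < (1 : ℝ)} := by
    rw [hcar]; ext z; simp [Complex.mem_reProdIm, and_assoc]
  have hrange : Set.range R.pt =
      {(0 : ℂ), ((A : ℝ) : ℂ), ((A : ℝ) : ℂ) + ((1 : ℝ) : ℂ) * Complex.I, ((1 : ℝ) : ℂ) * Complex.I} := by
    obtain ⟨h0, h1, h2, h3⟩ := hpt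
    ext z
    simp only [Set.mem_range, Set.mem_insert_iff, Set.mem_singleton_iff]
    constructor
    · rintro ⟨i, rfl⟩
      fin_cases i
      · exact Or.inr (Or.inr (Or.inr h0))
      · exact Or.inl h1
      · exact Or.inr (Or.inl h2)
      · exact Or.inr (Or.inr (Or.inl h3))
    · rintro (rfl | rfl | rfl | rfl)
      exacts [⟨1, h1⟩, ⟨2, h2⟩, ⟨3, h3⟩, ⟨0, h0⟩]
  have hlim : R.HasCrossingLimit (bondDomainCrossingProb R) cardyFunction :=
    hCR R A 1 hA' one_pos hcar' hrange
  obtain ⟨φ, x, hφx⟩ := MarkedDomain.exists_isUniformizing_holds R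
  -- the modulus of the corner-marked box `(0,A)×(0,1)` is `λ(iA)`
  have hcr : crossRatio x = KlebanZagier.lamR A := by
    have h := rectangle_crossRatio_eq_lamR R (w := (A : ℝ)) (h := 1) hA' one_pos hcar hpt φ x hφx
    rwa [div_one] at h
  have ht : Tendsto (fun k : ℕ ↦ bondDomainCrossingProb R (1 / (k : ℝ))) atTop
      (𝓝 (cardyFunction (KlebanZagier.lamR A))) :=
    hcr ▸ RectCardyOneOfParts.tendsto_comp_one_div_of_hasCrossingLimit hlim hφx
  -- replace the discretised crossing probability by the lattice one for `k ≥ 2`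
  refine ht.congr' ?_
  filter_upwards [eventually_ge_atTop 2] with k hk
  exact rc_box_dictionary R A k hA hk hcar harc0 harc2

/-- **The γ₁-half of `StripClusterRates` is a corollary of `CardyRectangle`**: if Cardy's formula holds
for the corner-marked rectangles, every family of one-cluster lengthwise rates
`γ₁(n) = lim_m −log P_{1/2}[LR crossing of [0,m]×[0,n]]/m` (`n ≥ 1`) has the Kac limit
`n·γ₁(n) → π/3 = π·h_{1,3}` (lead −1's landed sandwich composition `stub_composeOne`). [cite: Cardy1998, eq. (bb)] -/
theorem oneClusterKac_of_cardyRectangle :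
    Summit.CriticalPhenomena.CardyFormulaZ2.Theses.CardyPolygonWords.CardyRectangle → ∀ γ : ℕ → ℝ,
      (∀ n : ℕ, 1 ≤ n →
      Tendsto (fun m : ℕ ↦ -Real.log (crossingProb half m n) / (m : ℝ)) atTop (𝓝 (γ n))) →
      Tendsto (fun n : ℕ ↦ (n : ℝ) * γ n) atTop (𝓝 (Real.pi / 3)) :=
  fun h γ hγ => stub_composeOne stub_sandwichUpper stub_lamRLog stub_cardyLog
    (rc_rectCardyOne_of_cardyRectangle h) γ hγ

/-- **`StripClusterRates` ⟸ `CardyRectangle` ∧ K₂**: Cardy's formula for corner-marked rectangles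
(stmt-CriticalPhenomena-4782) and the two-cluster Kac gap statement K₂ (`n·(−log s(n)) → 2π` for every
family of relaxation moduli of the stationary connectivity chains, registered stub `stub_kacTwo`) imply the
crux — the rates come from the landed RateIsGap theorems, the γ₁-limit from
`oneClusterKac_of_cardyRectangle`, the γ₂-limit is K₂ at `s(n) = e^{−γ₂(n)}`. [cite: Cardy1998, eq. (bb)] -/
theorem stripClusterRates_of_cardyRectangle_of_kacTwo :
    Summit.CriticalPhenomena.CardyFormulaZ2.Theses.CardyPolygonWords.CardyRectangle →
    (∀ s : ℕ → ℝ,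
      (∀ n : ℕ, 1 ≤ n →
        ((∃ (μ : ℂ) (v : PlanarRowState (Finset.Icc (0 : ℤ) n) → ℂ),
          (v ≠ 0 ∧ (∀ p, (∃ x, p.1.JoinedToStar x) → v p = 0) ∧
            ∀ p, (∀ x, ¬ p.1.JoinedToStar x) →
              ∑ q, (planarTransfer (Finset.Icc (0 : ℤ) n) p q : ℂ) * v q = μ * v p) ∧
          μ ≠ 1 ∧ ‖μ‖ = s n) ∧
        ∀ (μ : ℂ) (v : PlanarRowState (Finset.Icc (0 : ℤ) n) → ℂ),
          (v ≠ 0 ∧ (∀ p, (∃ x, p.1.JoinedToStar x) → v p = 0) ∧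
            ∀ p, (∀ x, ¬ p.1.JoinedToStar x) →
              ∑ q, (planarTransfer (Finset.Icc (0 : ℤ) n) p q : ℂ) * v q = μ * v p) →
          μ ≠ 1 → ‖μ‖ ≤ s n)) →
      Tendsto (fun n : ℕ ↦ (n : ℝ) * -Real.log (s n)) atTop (𝓝 (2 * Real.pi))) →
    Summit.CriticalPhenomena.CardyFormulaZ2.Theses.CardyBoundaryCoulombGas.StripClusterRates := by
  intro hCR hK₂
  have h₁ := oneClusterRate_eq_escapeRate
  have h₂ := twoClusterRate_eq_relaxationRate
  let γ₁ : ℕ → ℝ := fun n => if hn : 1 ≤ n then (h₁ n hn).choose else 0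
  let γ₂ : ℕ → ℝ := fun n => if hn : 1 ≤ n then (h₂ n hn).choose else 0
  have hγ₁ : ∀ n : ℕ, ∀ hn : 1 ≤ n, γ₁ n = (h₁ n hn).choose := fun n hn => dif_pos hn
  have hγ₂ : ∀ n : ℕ, ∀ hn : 1 ≤ n, γ₂ n = (h₂ n hn).choose := fun n hn => dif_pos hn
  have hrate₁ : ∀ n : ℕ, 1 ≤ n →
      Tendsto (fun m : ℕ ↦ -Real.log (crossingProb half m n) / (m : ℝ)) atTop (𝓝 (γ₁ n)) := by
    intro n hn
    rw [hγ₁ n hn]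
    exact (h₁ n hn).choose_spec.1
  refine ⟨γ₁, γ₂, hrate₁, ?_, oneClusterKac_of_cardyRectangle hCR γ₁ hrate₁, ?_⟩
  · intro n hn
    rw [hγ₂ n hn]
    exact (h₂ n hn).choose_spec.1
  · have h := hK₂ (fun n => Real.exp (-γ₂ n)) (fun n hn => by rw [hγ₂ n hn]; exact (h₂ n hn).choose_spec.2)
    refine h.congr' (Eventually.of_forall fun n => ?_)
    exact red_mul_neg_log_exp_neg n (γ₂ n)

end Summit.CriticalPhenomena.CardyFormulaZ2.Cruxes.StripClusterRates.TwoClusterRateIsStationaryGap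

end
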